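import Summits.QuantumFields.YangMills.Theorems.BalabanUVNodesN15KingModelTwoPointInfiniteVolumeDecay

/-!
# BalabanUVNodes ∕ N15 — THE KING-MODEL RUNG (PART Ϝ-m): SYMMETRIES AND POSITIVITY OF THE INFINITE-VOLUME TWO-POINT FUNCTION —
# `S₂^{ℝ}(−z) = S₂^{ℝ}(z)`, invariance under coordinate permutations and reflections (the hyperoctahedral group of `ℤ^{d+1}`), and positive-definiteness on `ℤ^{d+1}`
# (Track A, DAG node N15 = NE2; FAN-OUT v1.1 §N15 s3 «KING-MODEL RUNG … NE2's analogue DECIDED in the model»)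

HONEST FRAMING.  Count-neutral (cell `pub-ymgap`, seat `pub-ymgap-dag-n15-e` g33; `--supports stmt-QuantumFields-27366 --as helper` = K3⁸
`SpineGivenEndpointR13SepCoPHV`).  TEMPLATE LITERATURE: C. King, *The U(1) Higgs model. I. The continuum limit*, Commun. Math. Phys. **102** (1986) 649–677
[King1986] — KING's OWN `A = 0`, `g = 0` MODEL: the block-smeared two-point function of the free massive field on `ℝ^{d+1}`, `S₂^{ℝ}(z) = (2π)^{−(d+1)}∫|u⁰(p)|²cos(p·z)∕(|p|²+m²)dp`
(part Ϝ-j).  Lattice-symmetry statements of [King1986II] §2 type for the FREE model only; NOT the interacting model; NOT Bałaban's objects; NOT a node discharge (N15 is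
booked through n15-a's knit, untouched here); nothing continuum-Yang–Mills ∕ ℝ⁴ ∕ OS ∕ mass-gap ∕ Clay.  0 `sorry`; standard axioms; ONE plumbing def (`latReflIdx`).

THE MATHEMATICS.  The integrand `h_z(p) = g(p)cos(p·z)`, `g(p) = Π_νsinc²(p_ν∕2)∕(|p|²+m²)`, satisfies `h_{−z} = h_z` (cosine is even), `h_{z∘σ}(p) = h_z(p∘σ⁻¹)` for a
coordinate permutation `σ` and `h_{ρ_μz}(p) = h_z(ρ_μp)` for the reflection `ρ_μ` of the `μ`-th coordinate (`g` is a symmetric function of `(p_ν)` and even in each);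
Lebesgue measure on `ℝ^{d+1}` is invariant under `p ↦ p∘σ⁻¹` (`MeasurableEquiv.piCongrLeft`) and `ρ_μ` (`MeasurableEquiv.piCongrRight` with `neg` in slot `μ`), so
`S₂^{ℝ}` is invariant under the hyperoctahedral group.  POSITIVITY: for a finitely supported `c : ℤ^{d+1} → ℝ`, push `c` forward to the torus `Ω_k = (ℤ∕(k+1))^{d+1}`
(`J_k(b) = Σ_{z: z mod M = b} c_z`); part Ϝ-d's `Σ_{b,b′}J S₂^{(∞)}_Ω J ≥ 0` expands (no injectivity needed) to `Σ_{z,z′} c_z c_{z′} S₂^{(∞)}_{Ω_k}(0, (z′−z) mod M_k) ≥ 0`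
(translation invariance), and each term tends to `S₂^{ℝ}(z′ − z)` (part Ϝ-j): `Σ_{z,z′} c_z c_{z′} S₂^{ℝ}(z′ − z) ≥ 0`.

WHAT THIS FILE PROVES (kernel).  §1 `kingS2Inf_neg` (even), `twoPtIntegrand_perm`, ★★ **`kingS2Inf_perm`** (coordinate permutations), `latReflIdx`, `twoPtIntegrand_refl`, ★★ **`kingS2Inf_refl`**
(coordinate reflections).  §2 `sum_pushforward_form` (the expansion letter), ★★★ **`kingS2Inf_posSemidef`** (`S₂^{ℝ}` is a positive-definite function on `ℤ^{d+1}`).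

HONEST SCOPE.  Free field; unit-block smearing; `m² > 0`.  Full `O(d+1)` invariance is NOT claimed (the block smearing breaks it; only the lattice symmetries survive).
N15 untouched; counts unmoved.  Locators: [King1986] Thm 2.1 (2.22) p.654, (4.5) p.670; [King1986II] §2 (lattice symmetries, template only).
-/

noncomputable section

open scoped BigOperators
open Finset Filter Topology MeasureTheory

namespace Summit.QuantumFields.YangMills.BalabanUVNodes.N15KingModelRung

open Literature.MathematicalPhysics.QuantumFieldTheory.Balaban1983to89.B5Prop11Plancherel (Tor fine chi sOf)
open Literature.MathematicalPhysics.QuantumFieldTheory.King1986 (momSq)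
open Literature.MathematicalPhysics.QuantumFieldTheory.King1986.Torus

variable {d : ℕ}

/-! ## §1 Evenness, permutations, reflections -/

/-- `S₂^{ℝ}(−z) = S₂^{ℝ}(z)`. [cite: King1986, Thm 2.1 (2.22) p.654] -/
theorem kingS2Inf_neg (m2 : ℝ) (z : Fin (d + 1) → ℤ) : kingS2Inf m2 (-z) = kingS2Inf m2 z := by
  unfold kingS2Inf twoPtIntegrand
  congr 1
  refine integral_congr_ae (Filter.Eventually.of_forall fun p => ?_)
  simp only [Pi.neg_apply, Int.cast_neg, mul_neg, Finset.sum_neg_distrib, Real.cos_neg]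

/-- The integrand under a coordinate permutation: `h_{z∘σ}(p) = h_z(p∘σ⁻¹)`. [folklore] -/
theorem twoPtIntegrand_perm (m2 : ℝ) (z : Fin (d + 1) → ℤ) (σ : Equiv.Perm (Fin (d + 1))) (p : Fin (d + 1) → ℝ) :
    twoPtIntegrand m2 (z ∘ σ) p = twoPtIntegrand m2 z (p ∘ σ.symm) := by
  unfold twoPtIntegrand
  have h1 : ‖uWeight0 (p ∘ σ.symm)‖ ^ 2 = ‖uWeight0 p‖ ^ 2 := by
    rw [norm_uWeight0, norm_uWeight0]
    congr 1
    exact Fintype.prod_equiv σ.symm _ _ fun ν => rfl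
  have h2 : momSq (p ∘ σ.symm) = momSq p := by
    unfold momSq
    exact Fintype.sum_equiv σ.symm _ _ fun ν => rfl
  have h3 : ∑ ν, (p ∘ σ.symm) ν * (z ν : ℝ) = ∑ ν, p ν * ((z ∘ σ) ν : ℝ) :=
    Fintype.sum_equiv σ.symm _ _ fun ν => by simp
  rw [h1, h2, h3]

/-- ★★ **INVARIANCE UNDER COORDINATE PERMUTATIONS**: `S₂^{ℝ}(z∘σ) = S₂^{ℝ}(z)`. [cite: King1986, Thm 2.1 (2.22) p.654] -/
theorem kingS2Inf_perm (m2 : ℝ) (z : Fin (d + 1) → ℤ) (σ : Equiv.Perm (Fin (d + 1))) : kingS2Inf m2 (z ∘ σ) = kingS2Inf m2 z := by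
  unfold kingS2Inf
  congr 1
  have hmp := volume_measurePreserving_piCongrLeft (fun _ : Fin (d + 1) => ℝ) σ
  have happ : ∀ x : Fin (d + 1) → ℝ, (MeasurableEquiv.piCongrLeft (fun _ : Fin (d + 1) => ℝ) σ) x = x ∘ σ.symm := fun x => by
    funext i
    rw [MeasurableEquiv.coe_piCongrLeft, Function.comp_apply, Equiv.piCongrLeft_apply_eq_cast]
    rfl
  rw [← hmp.integral_comp' (twoPtIntegrand m2 z)]
  refine integral_congr_ae (Filter.Eventually.of_forall fun x => ?_)
  simp only [happ, twoPtIntegrand_perm]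

/-- The reflection of the `μ`-th coordinate of an integer vector. [folklore] -/
def latReflIdx (μ : Fin (d + 1)) (z : Fin (d + 1) → ℤ) : Fin (d + 1) → ℤ := fun ν => if ν = μ then -z ν else z ν

/-- The integrand under a coordinate reflection: `h_{ρ_μz}(p) = h_z(ρ_μp)`. [folklore] -/
theorem twoPtIntegrand_refl (m2 : ℝ) (z : Fin (d + 1) → ℤ) (μ : Fin (d + 1)) (p : Fin (d + 1) → ℝ) :
    twoPtIntegrand m2 (latReflIdx μ z) p = twoPtIntegrand m2 z (fun ν => if ν = μ then -p ν else p ν) := by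
  unfold twoPtIntegrand latReflIdx
  have h1 : ‖uWeight0 (fun ν => if ν = μ then -p ν else p ν)‖ ^ 2 = ‖uWeight0 p‖ ^ 2 := by
    rw [norm_uWeight0, norm_uWeight0, ← Finset.prod_pow, ← Finset.prod_pow]
    refine Finset.prod_congr rfl fun ν _ => ?_
    rw [norm_sq_uFac0_eq_sinc_sq, norm_sq_uFac0_eq_sinc_sq]
    split_ifs
    · rw [show -p ν / 2 = -(p ν / 2) by ring, Real.sinc_neg]
    · rfl
  have h2 : momSq (fun ν => if ν = μ then -p ν else p ν) = momSq p := by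
    unfold momSq
    refine Finset.sum_congr rfl fun ν _ => ?_
    show (if ν = μ then -p ν else p ν) ^ 2 = p ν ^ 2
    split_ifs <;> ring
  have h3 : ∑ ν, (if ν = μ then -p ν else p ν) * (z ν : ℝ) = ∑ ν, p ν * ((if ν = μ then -z ν else z ν : ℤ) : ℝ) := by
    refine Finset.sum_congr rfl fun ν _ => ?_
    split_ifs <;> push_cast <;> ring
  rw [h1, h2, h3]

/-- ★★ **INVARIANCE UNDER COORDINATE REFLECTIONS**: `S₂^{ℝ}(ρ_μz) = S₂^{ℝ}(z)`. [cite: King1986, Thm 2.1 (2.22) p.654] -/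
theorem kingS2Inf_refl (m2 : ℝ) (z : Fin (d + 1) → ℤ) (μ : Fin (d + 1)) : kingS2Inf m2 (latReflIdx μ z) = kingS2Inf m2 z := by
  unfold kingS2Inf
  congr 1
  -- the reflection as a measure-preserving measurable equivalence of `ℝ^{d+1}`
  let e : ∀ _ : Fin (d + 1), ℝ ≃ᵐ ℝ := fun ν => if ν = μ then MeasurableEquiv.neg ℝ else MeasurableEquiv.refl ℝ
  have he : ∀ ν, MeasurePreserving (e ν) := fun ν => by
    by_cases h : ν = μ
    · simp only [e, if_pos h]; exact Measure.measurePreserving_neg volume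
    · simp only [e, if_neg h]; exact MeasurePreserving.id volume
  have hmp : MeasurePreserving (MeasurableEquiv.piCongrRight e) := by
    have := volume_preserving_pi (fun ν => he ν)
    exact this
  have happ : ∀ x : Fin (d + 1) → ℝ, (MeasurableEquiv.piCongrRight e) x = fun ν => if ν = μ then -x ν else x ν := fun x => by
    funext ν
    show (e ν) (x ν) = _
    by_cases h : ν = μ
    · simp only [e, if_pos h]; rfl
    · simp only [e, if_neg h]; rfl
  rw [← hmp.integral_comp' (twoPtIntegrand m2 z)]
  refine integral_congr_ae (Filter.Eventually.of_forall fun x => ?_)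
  simp only [happ, twoPtIntegrand_refl]

/-! ## §2 Positive-definiteness on `ℤ^{d+1}` -/

/-- The expansion letter: for `J = Σ_{z∈s}[f z = ·]c_z` (push-forward of `c` along any map `f`),
`Σ_{b,b′} J(b)S(b,b′)J(b′) = Σ_{z,z′∈s} c_z c_{z′} S(f z, f z′)`. [folklore] -/
theorem sum_pushforward_form {ι : Type*} [Fintype ι] [DecidableEq ι] (S : ι → ι → ℝ) (s : Finset (Fin (d + 1) → ℤ)) (c : (Fin (d + 1) → ℤ) → ℝ)
    (f : (Fin (d + 1) → ℤ) → ι) :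
    ∑ b, ∑ b', (∑ z ∈ s, if f z = b then c z else 0) * S b b' * (∑ z' ∈ s, if f z' = b' then c z' else 0)
      = ∑ z ∈ s, ∑ z' ∈ s, c z * S (f z) (f z') * c z' := by
  -- collapse the inner sum over `b′`
  have hinner : ∀ b, ∑ b', S b b' * (∑ z' ∈ s, if f z' = b' then c z' else 0) = ∑ z' ∈ s, S b (f z') * c z' := by
    intro b
    have h1 : ∀ b', S b b' * (∑ z' ∈ s, if f z' = b' then c z' else 0) = ∑ z' ∈ s, (if f z' = b' then S b b' * c z' else 0) := fun b' => by
      rw [Finset.mul_sum]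
      exact Finset.sum_congr rfl fun z' _ => by split_ifs <;> simp
    simp_rw [h1]
    rw [Finset.sum_comm]
    exact Finset.sum_congr rfl fun z' _ => by rw [Finset.sum_ite_eq]; simp
  -- collapse the outer sum over `b`
  have houter : ∀ b b', (∑ z ∈ s, if f z = b then c z else 0) * S b b' * (∑ z' ∈ s, if f z' = b' then c z' else 0)
      = (∑ z ∈ s, if f z = b then c z else 0) * (S b b' * (∑ z' ∈ s, if f z' = b' then c z' else 0)) := fun b b' => by ring
  simp_rw [houter, ← Finset.mul_sum, hinner]
  have h2 : ∀ b, (∑ z ∈ s, if f z = b then c z else 0) * (∑ z' ∈ s, S b (f z') * c z')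
      = ∑ z ∈ s, (if f z = b then c z * ∑ z' ∈ s, S b (f z') * c z' else 0) := fun b => by
    rw [Finset.sum_mul]
    exact Finset.sum_congr rfl fun z _ => by split_ifs <;> simp
  simp_rw [h2]
  rw [Finset.sum_comm]
  refine Finset.sum_congr rfl fun z _ => ?_
  rw [Finset.sum_ite_eq]
  simp only [Finset.mem_univ, if_true, Finset.mul_sum]
  exact Finset.sum_congr rfl fun z' _ => by ring

/-- ★★★ **`S₂^{ℝ}` IS A POSITIVE-DEFINITE FUNCTION ON `ℤ^{d+1}`**: for every finite `s ⊂ ℤ^{d+1}` and coefficients `c`, `Σ_{z,z′∈s} c_z·S₂^{ℝ}(z′ − z)·c_{z′} ≥ 0` (`m² > 0`).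
[cite: King1986, Thm 2.1 (2.22) p.654, (2.14) p.653] -/
theorem kingS2Inf_posSemidef {m2 : ℝ} (hm : 0 < m2) (s : Finset (Fin (d + 1) → ℤ)) (c : (Fin (d + 1) → ℤ) → ℝ) :
    0 ≤ ∑ z ∈ s, ∑ z' ∈ s, c z * kingS2Inf m2 (z' - z) * c z' := by
  -- cubic tori `(ℤ∕(k+1))^{d+1}`
  set Mseq : ℕ → Fin (d + 1) → ℕ := fun k _ => k + 1 with hMseq
  have hpos : ∀ k ν, 0 < Mseq k ν := fun k _ => Nat.succ_pos k
  have hlimM : ∀ ν, Tendsto (fun k => (Mseq k ν : ℝ)) atTop atTop := fun ν => by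
    have : Tendsto (fun k : ℕ => ((k : ℝ) + 1)) atTop atTop := tendsto_atTop_add_const_right _ 1 tendsto_natCast_atTop_atTop
    exact this.congr fun k => by simp [hMseq]
  -- the finite double sum on the torus converges to the target
  have hterm : ∀ z z', Tendsto (fun k => haveI : ∀ ν, NeZero (Mseq k ν) := fun ν => ⟨(hpos k ν).ne'⟩
      c z * kingS2Lim (Mseq k) m2 (fun ν => ((z ν : ℤ) : ZMod (Mseq k ν))) (fun ν => ((z' ν : ℤ) : ZMod (Mseq k ν))) * c z') atTop
      (𝓝 (c z * kingS2Inf m2 (z' - z) * c z')) := by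
    intro z z'
    have h := tendsto_kingS2Lim_volume hm Mseq hpos hlimM (z' - z)
    refine ((h.const_mul (c z)).mul_const (c z')).congr fun k => ?_
    haveI : ∀ ν, NeZero (Mseq k ν) := fun ν => ⟨(hpos k ν).ne'⟩
    congr 2
    have htr := kingS2Lim_transl (Mseq k) m2 0 (fun ν => (((z' - z) ν : ℤ) : ZMod (Mseq k ν))) (fun ν => ((z ν : ℤ) : ZMod (Mseq k ν)))
    rw [zero_add] at htr
    rw [← htr]
    congr 1
    funext ν
    simp
  have hsum := tendsto_finsetSum s fun z _ => tendsto_finsetSum s fun z' _ => hterm z z'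
  refine ge_of_tendsto hsum (Filter.Eventually.of_forall fun k => ?_)
  haveI : ∀ ν, NeZero (Mseq k ν) := fun ν => ⟨(hpos k ν).ne'⟩
  -- the torus form is nonnegative (part Ϝ-d), expanded by the push-forward letter
  have h0 := kingS2Lim_form_nonneg 3 (Mseq k) (by decide) (by norm_num) hm
    (fun b => ∑ z ∈ s, if (fun ν => ((z ν : ℤ) : ZMod (Mseq k ν))) = b then c z else 0)
  rw [sum_pushforward_form] at h0
  exact h0

end Summit.QuantumFields.YangMills.BalabanUVNodes.N15KingModelRung

end
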